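import Summits.QuantumFields.QCD.Theses.SpectralDefectExtinction
import Summits.QuantumFields.QCD.Theorems.SpectralDefectExtinctionTipNoBindingStubPositivity
import Summits.QuantumFields.QCD.Theorems.SpectralDefectExtinctionTipNoBindingStubSobolevSup
import Summits.QuantumFields.QCD.Theorems.SpectralDefectExtinctionTipNoBindingStubGreenBound
import Summits.QuantumFields.QCD.Theorems.SpectralDefectExtinctionTipNoBindingStubPerturbation
import Summits.QuantumFields.QCD.Theorems.SpectralDefectExtinctionTipNoBindingStubDiamagnetic
import Summits.QuantumFields.QCD.Theorems.SpectralDefectExtinctionTipNoBindingStubNoLeak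

/-!
# Line `positivity-no-leak-spread` for crux `SpectralDefectExtinction.TipNoBinding`
(item stmt-QuantumFields-8965, route route-QuantumFields-SpectralDefectExtinction) — LEAD'S SKELETON (reshaped r1;
re-seated lead prover-line-stmt-QuantumFields-8965-r-0, 2026-08-16: the four LANDED stubs `stub_positivity`
(Theorems/…StubPositivity), `stub_sobolevSup` (…StubSobolevSup), `stub_greenBound` (…StubGreenBound),
`stub_perturbation` (…StubPerturbation) are now IMPORTED from the tree and cited by name in `TipNoBinding_of`;
`stub_diamagnetic` (…StubDiamagnetic, this seat's worker) and `stub_noLeak` (…StubNoLeak, over the free-symbol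
helper file …FreeSymbol; this seat) are ALL LANDED under `Theorems/` and imported here; this file is the sorry-free
composition `TipNoBinding_of : SpectralDefectExtinction.TipNoBinding`)

A finitary, effective, torus-native proof that a gauge field supported in a fixed box binds NO real
eigenvalue of the massless `r = 1` Wilson–Dirac operator in `[1/√L, λ_R)`.

Reshape by the line lead (prover-line-stmt-QuantumFields-8965-lean-0, 2026-08-16): the planner's six stubs are
kept with the same mathematical content and constants, but every stub signature is now stated over TREE
VOCABULARY ONLY (`wilsonDirac`, `fundamentalRep`, `GaugeConfig`, `TorusSite`, `Site.shift`, `box`, `Torus.proj`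
+ Mathlib) — the skeleton's former local definitions `siteSq / siteNorm / covDiff / dirichlet / greenConst /
pertSupport / DW / Idx / SU3` are inlined — so that (i) each stub's helper file under `Theorems/` states the
registered signature literally and (ii) the final crux file is definition-free (pure proof).  `stub_perturbation`
is made existential in the support set `S` (the composition only consumes `|S| ≤ 5(2R+1)⁴`, the support
property and the `256` bound).

Mechanism.  Let `D = D_W(U,0,1)`, `D₀ = D_W(1,0,1)` (free), `B = D − D₀` (supported on `≤ 5(2R+1)⁴` sites `S`
one hop around the box image), and suppose `Dψ = tψ`, `t` real, `ψ ≠ 0`.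
* POSITIVITY (`stub_positivity`): `Re⟨ψ, Dψ⟩ = ½ Σ_{x,μ} ‖U(x,μ)ψ(x+μ̂) − ψ(x)‖²`, so `t‖ψ‖² = ½ Σ ‖∇^U ψ‖²`.
* SPREAD (`stub_diamagnetic` + `stub_sobolevSup` + `stub_greenBound`): the modulus `f = |ψ|` has lattice
  Dirichlet energy `≤ Σ‖∇^Uψ‖² = 2t‖ψ‖²` (Kato), and the four-torus Sobolev sup bound
  `f(x)² ≤ (2/L⁴)‖f‖² + 2 K_L · E(f)` with `K_L = L⁻⁴ Σ_{k≠0} 1/ε(k)` BOUNDED IN `L` (d = 4) gives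
  `|ψ(x)|² ≤ (2/L⁴ + 4Kt)‖ψ‖²` at every site.
* NO-LEAK (`stub_noLeak`): `(D₀ − t)ψ = −Bψ` is supported on `S`; Parseval on `(ZMod L)⁴`, the Clifford
  identity `‖((W−t) + iγ·s)v‖² = ((W−t)² + s²)‖v‖²`, `(W−t)² + s² ≥ ε(k)/4` for `k ≠ 0`, `t ≤ 1/4`, and the
  zero-mode cost `1/t² ≤ L` (where the floor `t ≥ 1/√L` is spent) give `‖ψ‖² ≤ (1/L³ + 4 K_L)·|S|·‖Bψ‖²`,
  and `‖Bψ‖² ≤ 256 Σ_{x∈S} |ψ(x)|²` (`stub_perturbation`).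
* Chaining: `1 ≤ 256·|S|²·(1+4K)·(2/L⁴ + 4Kt)`, impossible for `L⁴ ≥ 8A` and `t < λ_R := 1/(16·A·K)`,
  `A = 256·25(2R+1)⁸(1+4K)`.  `TipNoBinding_of` below cites the six landed `stub_*` theorems by name.

Disproof used: none exists for this crux yet (no `Cruxes/TipNoBinding/Disproof.lean` at reshape time).
-/

namespace Summit.QuantumFields.QCD.Cruxes.TipNoBinding.PositivityNoLeakSpread

open Literature.MathematicalPhysics Literature.MathematicalPhysics.QuantumLattice
  Literature.MathematicalPhysics.QuantumFieldTheory Literature.Probability.LatticeModels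
open Matrix

/-! ## Small helpers -/

/-- `Σ_i ‖ψ i‖² = Σ_x |ψ(x)|²`. -/
theorem sum_norm_sq_eq_sum_site {L : ℕ} [NeZero L] (ψ : TorusSite 4 L × Fin 3 × Fin 4 → ℂ) :
    ∑ i, ‖ψ i‖ ^ 2 = ∑ x, ∑ a, ∑ α, ‖ψ (x, a, α)‖ ^ 2 := by
  simp only [Fintype.sum_prod_type]

/-- `Re⟨ψ, t•ψ⟩ = t‖ψ‖²` for real `t`. -/
theorem re_star_dotProduct_smul {L : ℕ} [NeZero L] (ψ : TorusSite 4 L × Fin 3 × Fin 4 → ℂ) (t : ℝ) :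
    (star ψ ⬝ᵥ ((t : ℂ) • ψ)).re = t * ∑ i, ‖ψ i‖ ^ 2 := by
  rw [dotProduct_smul, smul_eq_mul, Complex.re_ofReal_mul, dotProduct, Complex.re_sum]
  congr 1
  refine Finset.sum_congr rfl fun i _ => ?_
  rw [Pi.star_apply]
  show ((starRingEnd ℂ) (ψ i) * ψ i).re = ‖ψ i‖ ^ 2
  rw [← Complex.normSq_eq_conj_mul_self, Complex.ofReal_re, Complex.normSq_eq_norm_sq]

/-! ## The composition: the six stubs imply the crux (concluded by name) -/

set_option maxHeartbeats 400000 in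
/-- **The skeleton IS the crux proof modulo the six declared stubs.**  `TipNoBinding_of` concludes
`SpectralDefectExtinction.TipNoBinding` BY NAME and uses exactly `stub_positivity`, `stub_diamagnetic`,
`stub_sobolevSup`, `stub_greenBound`, `stub_noLeak`, `stub_perturbation` (pulled in as the local hypotheses
`hpos hdia hsob hgreen hleak hpert` on the first six lines; nothing else is assumed).  Witnesses:
`λ_R = 1/(16·A·K)`, `A = 256·(5(2R+1)⁴)²·(1+4K)`, `K = max(K₀, 1)` with `K₀` from `stub_greenBound`,
`L₀ = ⌈8A⌉`.  Chain: eigenvector `ψ ≠ 0` (`Matrix.exists_mulVec_eq_zero_iff`); Kato `E(|ψ|) ≤ 2t‖ψ‖²`;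
Sobolev `|ψ(x)|² ≤ (2/L⁴ + 4Kt)‖ψ‖²`; no-leak + perturbation
`‖ψ‖² ≤ (1/L³+4K_L)|S|·256·|S|·(2/L⁴+4Kt)‖ψ‖² ≤ A(2/L⁴+4Kt)‖ψ‖² < ‖ψ‖²/2`. -/
theorem TipNoBinding_of :
    Summit.QuantumFields.QCD.Theses.SpectralDefectExtinction.TipNoBinding := by
  have hpos := stub_positivity
  have hdia := stub_diamagnetic
  have hsob := stub_sobolevSup
  have hgreen := stub_greenBound
  have hleak := stub_noLeak
  have hpert := stub_perturbation
  classical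
  obtain ⟨K₀, hK₀⟩ := hgreen
  intro R
  -- the constants of the line (facts first, then abbreviate)
  have hK1 : (1 : ℝ) ≤ max K₀ 1 := le_max_right _ _
  have hKle : K₀ ≤ max K₀ 1 := le_max_left _ _
  set K : ℝ := max K₀ 1 with hKdef
  have hK0 : 0 ≤ K := zero_le_one.trans hK1
  have hKpos : 0 < K := zero_lt_one.trans_le hK1
  have hR0 : (0 : ℝ) ≤ R := Nat.cast_nonneg R
  have hn1 : (1 : ℝ) ≤ 5 * (2 * (R : ℝ) + 1) ^ 4 := by
    have h1 : (1 : ℝ) ≤ (2 * (R : ℝ) + 1) ^ 4 := one_le_pow₀ (by linarith only [hR0])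
    linarith only [h1]
  set n : ℝ := 5 * (2 * (R : ℝ) + 1) ^ 4 with hndef
  have hn0 : 0 ≤ n := zero_le_one.trans hn1
  have hA1 : (1 : ℝ) ≤ 256 * n ^ 2 * (1 + 4 * K) := by
    have hn2 : (1 : ℝ) ≤ n ^ 2 := one_le_pow₀ hn1
    have hprod : 0 ≤ (n ^ 2 - 1) * K := mul_nonneg (sub_nonneg.mpr hn2) hK0
    nlinarith only [hn2, hK0, hprod]
  set A : ℝ := 256 * n ^ 2 * (1 + 4 * K) with hAdef
  have hA0 : 0 < A := zero_lt_one.trans_le hA1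
  have hAK : 0 < 16 * A * K := by positivity
  refine ⟨1 / (16 * A * K), one_div_pos.mpr hAK, ?_⟩
  obtain ⟨L₀, hL₀⟩ := exists_nat_ge (8 * A)
  refine ⟨L₀, ?_⟩
  intro L _ hL U hU t ht1 ht2 hdet
  -- real-number facts about L
  have hL1 : (1 : ℝ) ≤ L := by exact_mod_cast Nat.one_le_iff_ne_zero.mpr (NeZero.ne L)
  have hLpos : (0 : ℝ) < L := zero_lt_one.trans_le hL1
  have hL8 : 8 * A ≤ (L : ℝ) ^ 4 := by
    have h₁ : 8 * A ≤ (L : ℝ) := hL₀.trans (by exact_mod_cast hL)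
    have h₂ : (L : ℝ) ≤ (L : ℝ) ^ 4 := by
      calc (L : ℝ) = (L : ℝ) ^ 1 := (pow_one _).symm
        _ ≤ (L : ℝ) ^ 4 := pow_le_pow_right₀ hL1 (by norm_num)
    exact h₁.trans h₂
  have hL3 : 1 / (L : ℝ) ^ 3 ≤ 1 := by
    rw [div_le_one (by positivity)]
    exact one_le_pow₀ hL1
  -- the Green constant of this torus
  set G : ℝ := (1 / (L : ℝ) ^ 4) * ∑ k ∈ (Finset.univ : Finset (TorusSite 4 L)).filter (· ≠ 0),
      1 / (∑ μ, 4 * Real.sin (Real.pi * ((k μ).val : ℝ) / L) ^ 2) with hGdef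
  have hG0 : 0 ≤ G := by
    rw [hGdef]
    refine mul_nonneg (by positivity) (Finset.sum_nonneg fun k _ => ?_)
    refine div_nonneg zero_le_one (Finset.sum_nonneg fun μ _ => ?_)
    positivity
  have hGK : G ≤ K := (hK₀ L).trans hKle
  -- t is in the no-leak window
  have ht0 : 0 ≤ t := le_trans (by positivity) ht1
  have htlam : t * (16 * A * K) < 1 := (lt_div_iff₀ hAK).mp ht2
  have ht4 : t ≤ 1 / 4 := by
    have hprod : 0 ≤ (A - 1) * (K - 1) := mul_nonneg (sub_nonneg.mpr hA1) (sub_nonneg.mpr hK1)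
    have h16 : (16 : ℝ) ≤ 16 * A * K := by nlinarith only [hA1, hK1, hprod]
    have h' : 1 / (16 * A * K) ≤ 1 / (16 : ℝ) := one_div_le_one_div_of_le (by norm_num) h16
    linarith only [ht2, h']
  -- an eigenvector
  obtain ⟨ψ, hψne, hψ⟩ := Matrix.exists_mulVec_eq_zero_iff.mpr hdet
  have hEig : wilsonDirac (fundamentalRep (Fin 3)) U 0 1 *ᵥ ψ = (t : ℂ) • ψ := by
    rw [Matrix.sub_mulVec, Matrix.smul_mulVec, Matrix.one_mulVec, sub_eq_zero] at hψ
    exact hψ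
  set P : ℝ := ∑ i, ‖ψ i‖ ^ 2 with hPdef
  have hPpos : 0 < P := by
    obtain ⟨i, hi⟩ := Function.ne_iff.mp hψne
    exact Finset.sum_pos' (fun j _ => by positivity)
      ⟨i, Finset.mem_univ _, pow_pos (norm_pos_iff.mpr hi) 2⟩
  -- the site modulus `f = |ψ|` and its squares
  set f : TorusSite 4 L → ℝ := fun x => Real.sqrt (∑ a, ∑ α, ‖ψ (x, a, α)‖ ^ 2) with hfdef
  have hsq0 : ∀ x, 0 ≤ ∑ a, ∑ α, ‖ψ (x, a, α)‖ ^ 2 := fun x =>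
    Finset.sum_nonneg fun _ _ => Finset.sum_nonneg fun _ _ => by positivity
  have hfx : ∀ x, f x ^ 2 = ∑ a, ∑ α, ‖ψ (x, a, α)‖ ^ 2 := fun x => Real.sq_sqrt (hsq0 x)
  have hsumf : ∑ y, f y ^ 2 = P := by
    simp only [hfx, hPdef, sum_norm_sq_eq_sum_site]
  -- SPREAD, step 1 (Kato): the Dirichlet energy of |ψ| is at most 2 t ‖ψ‖²
  have hE : ∑ y, ∑ μ, (f (QuantumFieldTheory.Site.shift y μ) - f y) ^ 2 ≤ 2 * t * P := by
    have h1 : ∑ y, ∑ μ, (f (QuantumFieldTheory.Site.shift y μ) - f y) ^ 2 ≤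
        ∑ x, ∑ μ, ∑ a, ∑ α, ‖(∑ b, (U (x, μ) : Matrix (Fin 3) (Fin 3) ℂ) a b *
          ψ (QuantumFieldTheory.Site.shift x μ, b, α)) - ψ (x, a, α)‖ ^ 2 :=
      Finset.sum_le_sum fun x _ => Finset.sum_le_sum fun μ _ => hdia L U ψ x μ
    have h2 : (star ψ ⬝ᵥ (wilsonDirac (fundamentalRep (Fin 3)) U 0 1 *ᵥ ψ)).re = t * P := by
      rw [hEig, re_star_dotProduct_smul]
    have h3 := hpos L U ψ
    rw [h2] at h3
    linarith only [h1, h3]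
  -- SPREAD, step 2: every site carries at most (2/L⁴ + 4 K t) of the mass
  have hsite : ∀ x, ∑ a, ∑ α, ‖ψ (x, a, α)‖ ^ 2 ≤ (2 / (L : ℝ) ^ 4) * P + 4 * K * t * P := by
    intro x
    have h := hsob L f x
    rw [hfx, hsumf] at h
    have hD0 : 0 ≤ ∑ y, ∑ μ, (f (QuantumFieldTheory.Site.shift y μ) - f y) ^ 2 :=
      Finset.sum_nonneg fun _ _ => Finset.sum_nonneg fun _ _ => by positivity
    have h1 : G * ∑ y, ∑ μ, (f (QuantumFieldTheory.Site.shift y μ) - f y) ^ 2 ≤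
        K * ∑ y, ∑ μ, (f (QuantumFieldTheory.Site.shift y μ) - f y) ^ 2 :=
      mul_le_mul_of_nonneg_right hGK hD0
    have h2 : K * ∑ y, ∑ μ, (f (QuantumFieldTheory.Site.shift y μ) - f y) ^ 2 ≤ K * (2 * t * P) :=
      mul_le_mul_of_nonneg_left hE hK0
    linarith only [h, h1, h2]
  -- NO-LEAK: the free resolvent bound applied to φ = (D₀ − t)ψ = −Bψ
  obtain ⟨S, hcard, hpertψ⟩ := hpert R L U hU
  obtain ⟨hsupp, hnorm⟩ := hpertψ ψ
  have hφ : wilsonDirac (fundamentalRep (Fin 3))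
        (1 : GaugeConfig 4 L ↥(Matrix.specialUnitaryGroup (Fin 3) ℂ)) 0 1 *ᵥ ψ - (t : ℂ) • ψ =
      -((wilsonDirac (fundamentalRep (Fin 3)) U 0 1 -
          wilsonDirac (fundamentalRep (Fin 3))
            (1 : GaugeConfig 4 L ↥(Matrix.specialUnitaryGroup (Fin 3) ℂ)) 0 1) *ᵥ ψ) := by
    rw [Matrix.sub_mulVec, hEig, neg_sub]
  have hsuppφ : ∀ i : TorusSite 4 L × Fin 3 × Fin 4, i.1 ∉ S →
      (wilsonDirac (fundamentalRep (Fin 3))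
          (1 : GaugeConfig 4 L ↥(Matrix.specialUnitaryGroup (Fin 3) ℂ)) 0 1 *ᵥ ψ - (t : ℂ) • ψ) i = 0 := by
    intro i hi
    rw [hφ, Pi.neg_apply, hsupp i hi, neg_zero]
  have hC := hleak L t ht1 ht4 S ψ hsuppφ
  have hφnorm : ∑ i, ‖(wilsonDirac (fundamentalRep (Fin 3))
        (1 : GaugeConfig 4 L ↥(Matrix.specialUnitaryGroup (Fin 3) ℂ)) 0 1 *ᵥ ψ - (t : ℂ) • ψ) i‖ ^ 2 =
      ∑ i, ‖((wilsonDirac (fundamentalRep (Fin 3)) U 0 1 -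
          wilsonDirac (fundamentalRep (Fin 3))
            (1 : GaugeConfig 4 L ↥(Matrix.specialUnitaryGroup (Fin 3) ℂ)) 0 1) *ᵥ ψ) i‖ ^ 2 := by
    simp only [hφ, Pi.neg_apply, norm_neg]
  rw [hφnorm] at hC
  -- bookkeeping of constants
  set Q : ℝ := ∑ i, ‖((wilsonDirac (fundamentalRep (Fin 3)) U 0 1 -
      wilsonDirac (fundamentalRep (Fin 3))
        (1 : GaugeConfig 4 L ↥(Matrix.specialUnitaryGroup (Fin 3) ℂ)) 0 1) *ᵥ ψ) i‖ ^ 2 with hQdef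
  have hM₁ : 1 / (L : ℝ) ^ 3 + 4 * G ≤ 1 + 4 * K := by linarith only [hL3, hGK]
  have hc0 : (0 : ℝ) ≤ S.card := Nat.cast_nonneg _
  have hcn : (S.card : ℝ) ≤ n := by
    rw [hndef]
    exact_mod_cast hcard
  have hΦ₀0 : 0 ≤ (2 / (L : ℝ) ^ 4) * P + 4 * K * t * P := by positivity
  have hSum : ∑ x ∈ S, ∑ a, ∑ α, ‖ψ (x, a, α)‖ ^ 2 ≤ S.card * ((2 / (L : ℝ) ^ 4) * P + 4 * K * t * P) := by
    have := Finset.sum_le_card_nsmul S (fun x => ∑ a, ∑ α, ‖ψ (x, a, α)‖ ^ 2) _ fun x _ => hsite x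
    rw [nsmul_eq_mul] at this
    exact this
  have hQ0 : 0 ≤ Q := Finset.sum_nonneg fun _ _ => by positivity
  -- the chain  ‖ψ‖² ≤ A · (2/L⁴ + 4Kt) · ‖ψ‖²
  have hchain : P ≤ A * ((2 / (L : ℝ) ^ 4) * P + 4 * K * t * P) := by
    have h3 : (1 / (L : ℝ) ^ 3 + 4 * G) * S.card ≤ (1 + 4 * K) * n :=
      mul_le_mul hM₁ hcn hc0 (by linarith only [hK0])
    have h4 : Q ≤ 256 * (n * ((2 / (L : ℝ) ^ 4) * P + 4 * K * t * P)) :=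
      hnorm.trans (mul_le_mul_of_nonneg_left (hSum.trans (mul_le_mul_of_nonneg_right hcn hΦ₀0))
        (by norm_num))
    have h5 : 0 ≤ (1 + 4 * K) * n := by positivity
    calc P ≤ (1 / (L : ℝ) ^ 3 + 4 * G) * S.card * Q := hC
      _ ≤ (1 + 4 * K) * n * (256 * (n * ((2 / (L : ℝ) ^ 4) * P + 4 * K * t * P))) :=
          mul_le_mul h3 h4 hQ0 h5
      _ = A * ((2 / (L : ℝ) ^ 4) * P + 4 * K * t * P) := by
          rw [hAdef]; ring
  -- the two quarters
  have hq1 : A * ((2 / (L : ℝ) ^ 4) * P) ≤ P / 4 := by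
    have hL4 : (0 : ℝ) < (L : ℝ) ^ 4 := by positivity
    rw [show A * ((2 / (L : ℝ) ^ 4) * P) = (2 * A * P) / (L : ℝ) ^ 4 by ring, div_le_iff₀ hL4]
    calc 2 * A * P = P / 4 * (8 * A) := by ring
      _ ≤ P / 4 * (L : ℝ) ^ 4 := mul_le_mul_of_nonneg_left hL8 (by positivity)
  have hq2 : A * (4 * K * t * P) < P / 4 := by
    have h1 : A * (4 * K * t) < 1 / 4 := by linarith only [htlam]
    have h2 := mul_lt_mul_of_pos_right h1 hPpos
    linarith only [h2]
  have hlt : A * ((2 / (L : ℝ) ^ 4) * P + 4 * K * t * P) < P := by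
    rw [mul_add]
    linarith only [hq1, hq2, hPpos]
  exact absurd hchain (not_le.mpr hlt)

end Summit.QuantumFields.QCD.Cruxes.TipNoBinding.PositivityNoLeakSpread
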